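import Summits.CriticalPhenomena.PercolationContinuityZ3.Theorems.PercNearOneGluingNoHeavyLowerTailSahiCTCRtThreeBilinear
import HarnessLib

/-!
# `NoHeavyLowerTail` (crux stmt-CriticalPhenomena-4575), P3 lane: SINGLE-STEP ATOMS for the squarefree row of `R_3` and the first two
# corner sums (memo g49 §3; second of four proof files leading to separable certificates; definitions in `…RtThreeSepDefs`)

Support file (seat `prim-l12-p3`, gen 49; `--supports stmt-CriticalPhenomena-4575`).  Memo
`run/shared/lean/prim/prim-l12/FROM-prim-l12-p3-g49-SEPARABLE-CERTIFICATES.md` §3.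

SINGLE-STEP ATOMS `(A, u, B, w)` (`u ∉ A`, `w ∉ B`, all inside `V`) carry the products `([A+u ∈ 𝒳] − [A ∈ 𝒳])·([B+w ∈ 𝒵] − [B ∈ 𝒵])`,
nonnegative for up-sets (`atomSum_nonneg` for nonnegative weights).  They are weighted by functions of the TYPE
`(#(S∩S'), #(S∖S'), #(S'∖S))` of their top corner `(S,S') = (A+u, B+w)` and of the position of `u, w` (five tables `J, X, Ox, Oz, OO`,
`atomΩ`).  Expanding the product, each atom contributes to the four corners `(A+u,B+w), (A+u,B), (A,B+w), (A,B)`; this file evaluates the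
corner sums `corner_one` (top corner) and `corner_two` (`w` inserted on the right) as functions of the type; `…RtThreeCorners` does the
other two.  Nothing is asserted about the crux.
-/

noncomputable section

open scoped Classical

namespace Summit.CriticalPhenomena.PercolationContinuityZ3.Theorems.SahiCTCForms

open Finset MvPolynomial SahiCTCGenFun

variable {α : Type*} [DecidableEq α] [Fintype α]

/-! ### Single-step atoms and their weighted sum -/

section Atoms
variable (wJ wX wOx wOz wOO : ℕ → ℕ → ℕ → ℚ)

omit [Fintype α] in
/-- Every atom weight is one of the five table values. [this work] -/
theorem atomΩ_nonneg (hJ : ∀ a b c, 0 ≤ wJ a b c) (hX : ∀ a b c, 0 ≤ wX a b c) (hOx : ∀ a b c, 0 ≤ wOx a b c)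
    (hOz : ∀ a b c, 0 ≤ wOz a b c) (hOO : ∀ a b c, 0 ≤ wOO a b c) (S : Finset α) (u : α) (S' : Finset α) (v : α) :
    0 ≤ atomΩ wJ wX wOx wOz wOO S u S' v := by
  unfold atomΩ; split_ifs
  exacts [hJ _ _ _, hX _ _ _, hOx _ _ _, hOz _ _ _, hOO _ _ _]

omit [Fintype α] in
/-- For an up-set the indicator is monotone: `[A ∈ 𝒳] ≤ [A+u ∈ 𝒳]`. [this work] -/
theorem ιq_le_ιq_insert {F : Finset (Finset α)} (hF : IsUpperSet (F : Set (Finset α))) (A : Finset α) (u : α) :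
    ιq F A ≤ ιq F (insert u A) := by
  unfold ιq
  by_cases hA : A ∈ F
  · have : insert u A ∈ F := hF (subset_insert u A) hA
    simp [hA, this]
  · by_cases h' : insert u A ∈ F <;> simp [hA, h']

omit [Fintype α] in
/-- **The weighted atom sum is nonnegative** for up-sets and nonnegative weights. [this work] -/
theorem atomSum_nonneg {F G : Finset (Finset α)} (hF : IsUpperSet (F : Set (Finset α))) (hG : IsUpperSet (G : Set (Finset α)))
    (hJ : ∀ a b c, 0 ≤ wJ a b c) (hX : ∀ a b c, 0 ≤ wX a b c) (hOx : ∀ a b c, 0 ≤ wOx a b c)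
    (hOz : ∀ a b c, 0 ≤ wOz a b c) (hOO : ∀ a b c, 0 ≤ wOO a b c) (V : Finset α) :
    0 ≤ atomSum wJ wX wOx wOz wOO F G V := by
  unfold atomSum
  refine sum_nonneg fun A _ => sum_nonneg fun u _ => sum_nonneg fun B _ => sum_nonneg fun v _ => ?_
  refine mul_nonneg (atomΩ_nonneg wJ wX wOx wOz wOO hJ hX hOx hOz hOO _ _ _ _) (mul_nonneg ?_ ?_)
  · linarith [ιq_le_ιq_insert hF A u]
  · linarith [ιq_le_ιq_insert hG B v]

omit [Fintype α] in
/-- Reindexing the pairs `(A, u)`, `A ⊆ V`, `u ∈ V ∖ A`, by `S = A + u ∋ u`. [this work] -/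
theorem sum_powerset_sdiff_eq_sum_mem (V : Finset α) (f : Finset α → α → ℚ) :
    ∑ A ∈ V.powerset, ∑ u ∈ V \ A, f (insert u A) u = ∑ S ∈ V.powerset, ∑ u ∈ S, f S u := by
  -- both sides are sums over the pairs; exchange the order and use the bijection A ↦ insert u A (inverse: erase u)
  have hL : ∑ A ∈ V.powerset, ∑ u ∈ V \ A, f (insert u A) u = ∑ u ∈ V, ∑ A ∈ V.powerset.filter (fun A => u ∉ A), f (insert u A) u := by
    rw [sum_comm' (t' := V) (s' := fun u => V.powerset.filter fun A => u ∉ A)]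
    intro A u
    simp only [mem_powerset, mem_sdiff, mem_filter]
    tauto
  have hR : ∑ S ∈ V.powerset, ∑ u ∈ S, f S u = ∑ u ∈ V, ∑ S ∈ V.powerset.filter (fun S => u ∈ S), f S u := by
    rw [sum_comm' (t' := V) (s' := fun u => V.powerset.filter fun S => u ∈ S)]
    intro S u
    simp only [mem_powerset, mem_filter]
    constructor
    · rintro ⟨hS, hu⟩; exact ⟨⟨hS, hu⟩, hS hu⟩
    · rintro ⟨⟨hS, hu⟩, _⟩; exact ⟨hS, hu⟩
  rw [hL, hR]
  refine sum_congr rfl fun u hu => ?_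
  refine sum_bij (fun A _ => insert u A) (fun A hA => ?_) (fun A hA A' hA' h => ?_) (fun S hS => ?_) (fun A hA => rfl)
  · obtain ⟨hAV, huA⟩ := mem_filter.1 hA
    exact mem_filter.2 ⟨mem_powerset.2 (insert_subset hu (mem_powerset.1 hAV)), mem_insert_self u A⟩
  · have huA : u ∉ A := (mem_filter.1 hA).2
    have huA' : u ∉ A' := (mem_filter.1 hA').2
    rw [← erase_insert huA, h, erase_insert huA']
  · obtain ⟨hSV, huS⟩ := mem_filter.1 hS
    refine ⟨S.erase u, mem_filter.2 ⟨mem_powerset.2 ((erase_subset u S).trans (mem_powerset.1 hSV)), notMem_erase u S⟩, ?_⟩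
    exact insert_erase huS

end Atoms

/-! ### Block sums -/

omit [DecidableEq α] [Fintype α] in
/-- A double sum of a function that is constant on the block. [this work] -/
theorem sum_sum_const_of_eq {R₁ R₂ : Finset α} {Ω : α → α → ℚ} {w : ℚ} (h : ∀ u ∈ R₁, ∀ v ∈ R₂, Ω u v = w) :
    ∑ u ∈ R₁, ∑ v ∈ R₂, Ω u v = #R₁ * #R₂ * w := by
  rw [sum_congr rfl fun u hu => sum_congr rfl fun v hv => h u hu v hv]
  simp only [sum_const, nsmul_eq_mul]; ring

omit [Fintype α] in
/-- A double sum over `R × R` of a function taking one value on the diagonal and another off it. [this work] -/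
theorem sum_sum_diag_of_eq {R : Finset α} {Ω : α → α → ℚ} {wd wo : ℚ} (hd : ∀ u ∈ R, Ω u u = wd)
    (ho : ∀ u ∈ R, ∀ v ∈ R, u ≠ v → Ω u v = wo) :
    ∑ u ∈ R, ∑ v ∈ R, Ω u v = #R * wd + (#R * #R - #R) * wo := by
  have key : ∀ u ∈ R, ∑ v ∈ R, Ω u v = wd + (#R - 1) * wo := by
    intro u hu
    have h1 : ∑ v ∈ R, Ω u v = ∑ v ∈ R, (wo + if u = v then wd - wo else 0) := by
      refine sum_congr rfl fun v hv => ?_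
      by_cases huv : u = v
      · subst huv; rw [hd u hu]; simp
      · rw [ho u hu v hv huv]; simp [huv]
    rw [h1, sum_add_distrib, sum_const, nsmul_eq_mul, sum_ite_eq R u (fun _ => wd - wo), if_pos hu]
    ring
  rw [sum_congr rfl key, sum_const, nsmul_eq_mul]; ring

/-! ### The four corners -/

section Corners
variable (wJ wX wOx wOz wOO : ℕ → ℕ → ℕ → ℚ)

omit [Fintype α] in
/-- Corner `(A+u, B+v) = (S, S')`: `Σ_{u ∈ S, v ∈ S'} Ω(S,u,S',v) = a·J + a(a−1)·X + ab·Ox + ac·Oz + bc·OO` at `(a,b,c)`. [this work] -/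
theorem corner_one (S S' : Finset α) :
    ∑ u ∈ S, ∑ v ∈ S', atomΩ wJ wX wOx wOz wOO S u S' v =
      (#(S ∩ S') : ℚ) * wJ #(S ∩ S') #(S \ S') #(S' \ S) + (#(S ∩ S') * #(S ∩ S') - #(S ∩ S')) * wX #(S ∩ S') #(S \ S') #(S' \ S)
      + #(S \ S') * #(S ∩ S') * wOx #(S ∩ S') #(S \ S') #(S' \ S) + #(S ∩ S') * #(S' \ S) * wOz #(S ∩ S') #(S \ S') #(S' \ S)
      + #(S \ S') * #(S' \ S) * wOO #(S ∩ S') #(S \ S') #(S' \ S) := by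
  set a := #(S ∩ S'); set b := #(S \ S'); set c := #(S' \ S)
  set Ω := fun u v => atomΩ wJ wX wOx wOz wOO S u S' v with hΩ
  have hS : S = S ∩ S' ∪ S \ S' := by rw [union_comm, sdiff_union_inter]
  have hS' : S' = S ∩ S' ∪ S' \ S := by rw [inter_comm, union_comm, sdiff_union_inter]
  have hdS : Disjoint (S ∩ S') (S \ S') := disjoint_sdiff_inter S S' |>.symm
  have hdS' : Disjoint (S ∩ S') (S' \ S) := by rw [inter_comm]; exact (disjoint_sdiff_inter S' S).symm
  show ∑ u ∈ S, ∑ v ∈ S', Ω u v = _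
  conv_lhs => rw [hS]
  rw [sum_union hdS]
  have hsplit : ∀ u, ∑ v ∈ S', Ω u v = ∑ v ∈ S ∩ S', Ω u v + ∑ v ∈ S' \ S, Ω u v := fun u => by
    conv_lhs => rw [hS']
    rw [sum_union hdS']
  simp_rw [hsplit, sum_add_distrib]
  -- the four blocks
  have hII : ∑ u ∈ S ∩ S', ∑ v ∈ S ∩ S', Ω u v = a * wJ a b c + (a * a - a) * wX a b c := by
    refine sum_sum_diag_of_eq (fun u hu => ?_) (fun u hu v hv huv => ?_)
    · simp [hΩ, atomΩ, a, b, c]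
    · have hu' : u ∈ S' := (mem_inter.1 hu).2
      have hvS : v ∈ S := (mem_inter.1 hv).1
      simp [hΩ, atomΩ, huv, hu', hvS, a, b, c]
  have hIQ : ∑ u ∈ S ∩ S', ∑ v ∈ S' \ S, Ω u v = a * c * wOz a b c := by
    refine sum_sum_const_of_eq fun u hu v hv => ?_
    have hu' : u ∈ S' := (mem_inter.1 hu).2
    have hvS : v ∉ S := (mem_sdiff.1 hv).2
    have huv : u ≠ v := fun h => hvS (h ▸ (mem_inter.1 hu).1)
    simp [hΩ, atomΩ, huv, hu', hvS, a, b, c]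
  have hPI : ∑ u ∈ S \ S', ∑ v ∈ S ∩ S', Ω u v = b * a * wOx a b c := by
    refine sum_sum_const_of_eq fun u hu v hv => ?_
    have huS' : u ∉ S' := (mem_sdiff.1 hu).2
    have hvS : v ∈ S := (mem_inter.1 hv).1
    have hvS' : v ∈ S' := (mem_inter.1 hv).2
    have huv : u ≠ v := fun h => huS' (h ▸ hvS')
    simp [hΩ, atomΩ, huv, huS', hvS, a, b, c]
  have hPQ : ∑ u ∈ S \ S', ∑ v ∈ S' \ S, Ω u v = b * c * wOO a b c := by
    refine sum_sum_const_of_eq fun u hu v hv => ?_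
    have huS' : u ∉ S' := (mem_sdiff.1 hu).2
    have hvS : v ∉ S := (mem_sdiff.1 hv).2
    have huv : u ≠ v := fun h => hvS (h ▸ (mem_sdiff.1 hu).1)
    simp [hΩ, atomΩ, huv, huS', hvS, a, b, c]
  rw [hII, hIQ, hPI, hPQ]
  ring

end Corners

section Corners2
variable (wJ wX wOx wOz wOO : ℕ → ℕ → ℕ → ℚ)

omit [Fintype α] in
/-- The atom weight for `u = v` is the `J` table. [this work] -/
theorem atomΩ_J {S S' : Finset α} {u v : α} (h : u = v) :
    atomΩ wJ wX wOx wOz wOO S u S' v = wJ #(S ∩ S') #(S \ S') #(S' \ S) := by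
  unfold atomΩ; rw [if_pos h]

omit [Fintype α] in
/-- The atom weight for `u ≠ v`, `u ∈ S'`, `v ∈ S` is the `X` table. [this work] -/
theorem atomΩ_X {S S' : Finset α} {u v : α} (h : u ≠ v) (hu : u ∈ S') (hv : v ∈ S) :
    atomΩ wJ wX wOx wOz wOO S u S' v = wX #(S ∩ S') #(S \ S') #(S' \ S) := by
  unfold atomΩ; rw [if_neg h, if_pos ⟨hu, hv⟩]

omit [Fintype α] in
/-- The atom weight for `u ≠ v`, `u ∉ S'`, `v ∈ S` is the `Ox` table. [this work] -/
theorem atomΩ_Ox {S S' : Finset α} {u v : α} (h : u ≠ v) (hu : u ∉ S') (hv : v ∈ S) :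
    atomΩ wJ wX wOx wOz wOO S u S' v = wOx #(S ∩ S') #(S \ S') #(S' \ S) := by
  unfold atomΩ; rw [if_neg h, if_neg (fun h' => hu h'.1), if_pos hv]

omit [Fintype α] in
/-- The atom weight for `u ≠ v`, `v ∉ S`, `u ∈ S'` is the `Oz` table. [this work] -/
theorem atomΩ_Oz {S S' : Finset α} {u v : α} (h : u ≠ v) (hv : v ∉ S) (hu : u ∈ S') :
    atomΩ wJ wX wOx wOz wOO S u S' v = wOz #(S ∩ S') #(S \ S') #(S' \ S) := by
  unfold atomΩ; rw [if_neg h, if_neg (fun h' => hv h'.2), if_neg hv, if_pos hu]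

omit [Fintype α] in
/-- The atom weight for `u ≠ v`, `u ∉ S'`, `v ∉ S` is the `OO` table. [this work] -/
theorem atomΩ_OO {S S' : Finset α} {u v : α} (h : u ≠ v) (hu : u ∉ S') (hv : v ∉ S) :
    atomΩ wJ wX wOx wOz wOO S u S' v = wOO #(S ∩ S') #(S \ S') #(S' \ S) := by
  unfold atomΩ; rw [if_neg h, if_neg (fun h' => hv h'.2), if_neg hv, if_neg hu]

omit [Fintype α] in
/-- Cardinalities after inserting a point `v ∉ S'` on the right. [this work] -/
theorem card_inter_insert_right {S S' : Finset α} {v : α} (hv : v ∉ S') :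
    #(S ∩ insert v S') = #(S ∩ S') + (if v ∈ S then 1 else 0) := by
  by_cases h : v ∈ S
  · rw [inter_insert_of_mem h, card_insert_of_notMem (fun h' => hv (mem_inter.1 h').2), if_pos h]
  · rw [inter_insert_of_notMem h, if_neg h, add_zero]

omit [Fintype α] in
/-- `#(S ∖ (S' + v))` for `v ∉ S'`. [this work] -/
theorem card_sdiff_insert_right {S S' : Finset α} {v : α} (hv : v ∉ S') :
    #(S \ insert v S') + (if v ∈ S then 1 else 0) = #(S \ S') := by
  rw [sdiff_insert]
  by_cases h : v ∈ S
  · rw [if_pos h, card_erase_add_one (mem_sdiff.2 ⟨h, hv⟩)]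
  · rw [if_neg h, add_zero, erase_eq_of_notMem (fun h' => h (mem_sdiff.1 h').1)]

omit [Fintype α] in
/-- `#((S' + v) ∖ S)` for `v ∉ S'`. [this work] -/
theorem card_insert_sdiff_right {S S' : Finset α} {v : α} (hv : v ∉ S') :
    #(insert v S' \ S) = #(S' \ S) + (if v ∈ S then 0 else 1) := by
  by_cases h : v ∈ S
  · rw [insert_sdiff_of_mem S' h, if_pos h, add_zero]
  · rw [insert_sdiff_of_notMem S' h, card_insert_of_notMem (fun h' => hv (mem_sdiff.1 h').1), if_neg h]

omit [Fintype α] in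
/-- Cardinalities after inserting a point `u ∉ S` on the left. [this work] -/
theorem card_insert_inter_left {S S' : Finset α} {u : α} (hu : u ∉ S) :
    #(insert u S ∩ S') = #(S ∩ S') + (if u ∈ S' then 1 else 0) := by
  rw [inter_comm, card_inter_insert_right hu, inter_comm]

omit [Fintype α] in
/-- `#((S + u) ∖ S')` for `u ∉ S`. [this work] -/
theorem card_insert_sdiff_left {S S' : Finset α} {u : α} (hu : u ∉ S) :
    #(insert u S \ S') = #(S \ S') + (if u ∈ S' then 0 else 1) :=
  card_insert_sdiff_right hu

omit [Fintype α] in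
/-- `#(S' ∖ (S + u))` for `u ∉ S`. [this work] -/
theorem card_sdiff_insert_left {S S' : Finset α} {u : α} (hu : u ∉ S) :
    #(S' \ insert u S) + (if u ∈ S' then 1 else 0) = #(S' \ S) :=
  card_sdiff_insert_right hu

omit [Fintype α] in
/-- `V ∖ S' = (S ∖ S') ⊔ (V ∖ (S ∪ S'))` for `S ⊆ V`. [this work] -/
theorem sdiff_eq_sdiff_union_sdiff_union {V S S' : Finset α} (hS : S ⊆ V) :
    V \ S' = S \ S' ∪ V \ (S ∪ S') := by
  ext x; simp only [mem_sdiff, mem_union]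
  constructor
  · rintro ⟨hxV, hxS'⟩
    by_cases hxS : x ∈ S
    · exact Or.inl ⟨hxS, hxS'⟩
    · exact Or.inr ⟨hxV, fun h => h.elim hxS hxS'⟩
  · rintro (⟨hxS, hxS'⟩ | ⟨hxV, h⟩)
    · exact ⟨hS hxS, hxS'⟩
    · exact ⟨hxV, fun h' => h (Or.inr h')⟩

omit [Fintype α] in
/-- `S ∖ S'` and `V ∖ (S ∪ S')` are disjoint. [this work] -/
theorem disjoint_sdiff_sdiff_union (V S S' : Finset α) : Disjoint (S \ S') (V \ (S ∪ S')) :=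
  disjoint_left.2 fun _ hx hx' => (mem_sdiff.1 hx').2 (mem_union_left _ (mem_sdiff.1 hx).1)

omit [Fintype α] in
/-- Corner `(A+u, B) = (S, S')` (`v ∉ S'` inserted on the right). [this work] -/
theorem corner_two (V S S' : Finset α) (hS : S ⊆ V) :
    ∑ u ∈ S, ∑ v ∈ V \ S', atomΩ wJ wX wOx wOz wOO S u (insert v S') v =
      (#(S \ S') : ℚ) * wJ (#(S ∩ S') + 1) (#(S \ S') - 1) #(S' \ S)
      + #(S ∩ S') * #(S \ S') * wX (#(S ∩ S') + 1) (#(S \ S') - 1) #(S' \ S)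
      + (#(S \ S') * #(S \ S') - #(S \ S')) * wOx (#(S ∩ S') + 1) (#(S \ S') - 1) #(S' \ S)
      + #(S ∩ S') * #(V \ (S ∪ S')) * wOz #(S ∩ S') #(S \ S') (#(S' \ S) + 1)
      + #(S \ S') * #(V \ (S ∪ S')) * wOO #(S ∩ S') #(S \ S') (#(S' \ S) + 1) := by
  set a := #(S ∩ S'); set b := #(S \ S'); set c := #(S' \ S); set o := #(V \ (S ∪ S'))
  set Ω := fun u v => atomΩ wJ wX wOx wOz wOO S u (insert v S') v with hΩ
  have hSd : S = S ∩ S' ∪ S \ S' := by rw [union_comm, sdiff_union_inter]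
  have hdS : Disjoint (S ∩ S') (S \ S') := (disjoint_sdiff_inter S S').symm
  have hVd : V \ S' = S \ S' ∪ V \ (S ∪ S') := sdiff_eq_sdiff_union_sdiff_union hS
  have hdV : Disjoint (S \ S') (V \ (S ∪ S')) := disjoint_sdiff_sdiff_union V S S'
  -- cardinalities of the shifted corner
  have typP : ∀ v ∈ S \ S', #(S ∩ insert v S') = a + 1 ∧ #(S \ insert v S') = b - 1 ∧ #(insert v S' \ S) = c := by
    intro v hv
    obtain ⟨hvS, hvS'⟩ := mem_sdiff.1 hv
    refine ⟨by rw [card_inter_insert_right hvS', if_pos hvS], ?_, by rw [card_insert_sdiff_right hvS', if_pos hvS, add_zero]⟩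
    have := card_sdiff_insert_right (S := S) hvS'; rw [if_pos hvS] at this; omega
  have typO : ∀ v ∈ V \ (S ∪ S'), #(S ∩ insert v S') = a ∧ #(S \ insert v S') = b ∧ #(insert v S' \ S) = c + 1 := by
    intro v hv
    have hvS : v ∉ S := fun h => (mem_sdiff.1 hv).2 (mem_union_left _ h)
    have hvS' : v ∉ S' := fun h => (mem_sdiff.1 hv).2 (mem_union_right _ h)
    refine ⟨by rw [card_inter_insert_right hvS', if_neg hvS, add_zero], ?_, by rw [card_insert_sdiff_right hvS', if_neg hvS]⟩
    have := card_sdiff_insert_right (S := S) hvS'; rw [if_neg hvS] at this; omega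
  show ∑ u ∈ S, ∑ v ∈ V \ S', Ω u v = _
  conv_lhs => rw [hSd]
  rw [sum_union hdS]
  have hsplit : ∀ u, ∑ v ∈ V \ S', Ω u v = ∑ v ∈ S \ S', Ω u v + ∑ v ∈ V \ (S ∪ S'), Ω u v := fun u => by
    rw [hVd, sum_union hdV]
  simp_rw [hsplit, sum_add_distrib]
  have hIP : ∑ u ∈ S ∩ S', ∑ v ∈ S \ S', Ω u v = a * b * wX (a + 1) (b - 1) c := by
    refine sum_sum_const_of_eq fun u hu v hv => ?_
    obtain ⟨t1, t2, t3⟩ := typP v hv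
    have hvS : v ∈ S := (mem_sdiff.1 hv).1
    have huv : u ≠ v := fun h => (mem_sdiff.1 hv).2 (h ▸ (mem_inter.1 hu).2)
    rw [hΩ]; dsimp only
    rw [atomΩ_X _ _ _ _ _ huv (mem_insert_of_mem (mem_inter.1 hu).2) hvS, t1, t2, t3]
  have hPP : ∑ u ∈ S \ S', ∑ v ∈ S \ S', Ω u v = b * wJ (a + 1) (b - 1) c + (b * b - b) * wOx (a + 1) (b - 1) c := by
    refine sum_sum_diag_of_eq (fun u hu => ?_) (fun u hu v hv huv => ?_)
    · obtain ⟨t1, t2, t3⟩ := typP u hu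
      rw [hΩ]; dsimp only; rw [atomΩ_J _ _ _ _ _ rfl, t1, t2, t3]
    · obtain ⟨t1, t2, t3⟩ := typP v hv
      have huS' : u ∉ insert v S' := fun h => by
        rcases mem_insert.1 h with h | h
        · exact huv h
        · exact (mem_sdiff.1 hu).2 h
      rw [hΩ]; dsimp only; rw [atomΩ_Ox _ _ _ _ _ huv huS' (mem_sdiff.1 hv).1, t1, t2, t3]
  have hIO : ∑ u ∈ S ∩ S', ∑ v ∈ V \ (S ∪ S'), Ω u v = a * o * wOz a b (c + 1) := by
    refine sum_sum_const_of_eq fun u hu v hv => ?_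
    obtain ⟨t1, t2, t3⟩ := typO v hv
    have hvS : v ∉ S := fun h => (mem_sdiff.1 hv).2 (mem_union_left _ h)
    have huv : u ≠ v := fun h => hvS (h ▸ (mem_inter.1 hu).1)
    rw [hΩ]; dsimp only
    rw [atomΩ_Oz _ _ _ _ _ huv hvS (mem_insert_of_mem (mem_inter.1 hu).2), t1, t2, t3]
  have hPO : ∑ u ∈ S \ S', ∑ v ∈ V \ (S ∪ S'), Ω u v = b * o * wOO a b (c + 1) := by
    refine sum_sum_const_of_eq fun u hu v hv => ?_
    obtain ⟨t1, t2, t3⟩ := typO v hv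
    have hvS : v ∉ S := fun h => (mem_sdiff.1 hv).2 (mem_union_left _ h)
    have huv : u ≠ v := fun h => hvS (h ▸ (mem_sdiff.1 hu).1)
    have huS' : u ∉ insert v S' := fun h => by
      rcases mem_insert.1 h with h | h
      · exact huv h
      · exact (mem_sdiff.1 hu).2 h
    rw [hΩ]; dsimp only
    rw [atomΩ_OO _ _ _ _ _ huv huS' hvS, t1, t2, t3]
  rw [hIP, hPP, hIO, hPO]
  ring

end Corners2

end Summit.CriticalPhenomena.PercolationContinuityZ3.Theorems.SahiCTCForms
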